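import Summits.Ventures.PercRepro.S1Ladder

/-!
# PercRepro — THE COLOOP LADDER AT EVERY LEVEL `q` (p2, gen 21; a service module for S2 / S3 — SUBCLAIM-S1 §6.5 (v))

S1Ladder's exact coloop identity with the level `4` replaced by any `q ≥ 1`: for a coloop `e` of `M` (rank `r + 1 > q + 1`,
`n` points) `#U_M(r+1, q) = #U_{M∖e}(r, q)` and `#Y_M(r+1, q) + W_{≤q−1}(M∖e) = #Y_{M∖e}(r, q) + 2^{n−1}` — the `2^{n−1}`
subsets of `M ∖ e` split by rank into `≤ q − 1`, `= q`, `q < ρ < r`, `= r`. The sets of rank `≤ q − 1` are bounded by the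
core's flat sizes (`W_{≤q−1} ≤ Σ_{i≤f} C(n−1, i)` once every set of rank `≤ q − 1` has `≤ f` points: `f = 10` at `q = 5`
by PlaneTen, `f = 21` at `q = 6` by the cover recursion). Iterated over `c` coloops the cell at `(p + c, q)` reduces to the
coloop-free part at `(p, q)` with the credit `Σ_{j<c} (2^{n−1−j} − Σ_{i≤f} C(n−1−j, i))` on the `Y`-side; the lossy form
`#Y_M ≥ 2·#Y' + 2·#U'` needs nothing about flats.

* `two_pow_ncard_eq_q`, `ncard_subsets_card_le_of_rank_le`, `midCount_add_lowCount_of_isColoop_q'`,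
  `two_mul_midCount_add_le_of_isColoop_q'`;
* **`ladder_exact_q`**, **`ladder_lossy_q`**, **`rls_of_coloops_lossy_q`** (`Φ(p + c, q) ≤ 2(2^c − 1)` ⇒ `RLS` at `(p + c, q)`).
Axioms: standard.
-/

open scoped Matroid

namespace PercRepro

namespace S1

open Set

variable {α : Type}

/-- **The subsets of a matroid of rank `r > q`, partitioned by rank** (`q ≥ 1`):
`2^n = W_{≤q−1} + W_q + #Y(r, q) + W_r`. -/
theorem two_pow_ncard_eq_q (M : Matroid α) [M.Finite] {r q : ℕ} (hR : M.eRank = (r : ℕ∞)) (hq : q < r) (hq1 : 1 ≤ q) :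
    2 ^ M.E.ncard = lowCount M (q - 1) + Matroid.levelCount M q + Matroid.midCount M r q + Matroid.levelCount M r := by
  classical
  have hfin : (𝒫 M.E).Finite := M.ground_finite.powerset
  set S1 := {A : Set α | A ⊆ M.E ∧ M.eRk A ≤ ((q - 1 : ℕ) : ℕ∞)} with hS1
  set S2 := {A : Set α | A ⊆ M.E ∧ M.eRk A = (q : ℕ∞)} with hS2
  set S3 := {A : Set α | A ⊆ M.E ∧ (q : ℕ∞) < M.eRk A ∧ M.eRk A < (r : ℕ∞)} with hS3
  set S4 := {A : Set α | A ⊆ M.E ∧ M.eRk A = (r : ℕ∞)} with hS4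
  have hcover : 𝒫 M.E = S1 ∪ (S2 ∪ (S3 ∪ S4)) := by
    ext A
    simp only [mem_powerset_iff, mem_union, hS1, hS2, hS3, hS4, mem_setOf_eq]
    constructor
    · intro hA
      have hle : M.eRk A ≤ (r : ℕ∞) := by rw [← hR]; exact M.eRk_le_eRank A
      have hne : M.eRk A ≠ ⊤ := ne_top_of_le_ne_top (ENat.coe_ne_top r) hle
      obtain ⟨k, hk⟩ := ENat.ne_top_iff_exists.1 hne
      rw [← hk] at hle ⊢
      have hkr : k ≤ r := by exact_mod_cast hle
      rcases Nat.lt_or_ge k q with h3 | h4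
      · exact Or.inl ⟨hA, by exact_mod_cast (show k ≤ q - 1 by omega)⟩
      rcases Nat.eq_or_lt_of_le h4 with h4' | h4'
      · exact Or.inr (Or.inl ⟨hA, by rw [← h4']⟩)
      rcases Nat.lt_or_ge k r with hlt | hge
      · exact Or.inr (Or.inr (Or.inl ⟨hA, by exact_mod_cast h4', by exact_mod_cast hlt⟩))
      · exact Or.inr (Or.inr (Or.inr ⟨hA, by congr 1; omega⟩))
    · rintro (h | h | h | h) <;> exact h.1
  have hsub1 : S1 ⊆ 𝒫 M.E := fun A hA => hA.1
  have hsub2 : S2 ⊆ 𝒫 M.E := fun A hA => hA.1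
  have hsub3 : S3 ⊆ 𝒫 M.E := fun A hA => hA.1
  have hsub4 : S4 ⊆ 𝒫 M.E := fun A hA => hA.1
  have hd34 : Disjoint S3 S4 := by
    rw [Set.disjoint_left]
    rintro A ⟨-, -, h2⟩ ⟨-, h3⟩
    rw [h3] at h2
    exact lt_irrefl _ h2
  have hd2 : Disjoint S2 (S3 ∪ S4) := by
    rw [Set.disjoint_left]
    rintro A ⟨-, h2⟩ (⟨-, h3, -⟩ | ⟨-, h3⟩)
    · rw [h2] at h3; exact lt_irrefl _ h3
    · rw [h2] at h3
      have : q = r := by exact_mod_cast h3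
      omega
  have hd1 : Disjoint S1 (S2 ∪ (S3 ∪ S4)) := by
    rw [Set.disjoint_left]
    rintro A ⟨-, h1⟩ (⟨-, h2⟩ | ⟨-, h3, -⟩ | ⟨-, h4⟩)
    · rw [h2] at h1
      have : q ≤ q - 1 := by exact_mod_cast h1
      omega
    · have h5 : ((q : ℕ) : ℕ∞) < ((q - 1 : ℕ) : ℕ∞) := h3.trans_le h1
      have : q < q - 1 := by exact_mod_cast h5
      omega
    · rw [h4] at h1
      have : r ≤ q - 1 := by exact_mod_cast h1
      omega
  have h1 := Set.ncard_union_eq hd1 (hfin.subset hsub1) (hfin.subset (Set.union_subset hsub2 (Set.union_subset hsub3 hsub4)))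
  have h2 := Set.ncard_union_eq hd2 (hfin.subset hsub2) (hfin.subset (Set.union_subset hsub3 hsub4))
  have h3 := Set.ncard_union_eq hd34 (hfin.subset hsub3) (hfin.subset hsub4)
  rw [← Set.ncard_powerset M.E M.ground_finite, hcover, h1, h2, h3]
  unfold lowCount Matroid.levelCount Matroid.midCount
  simp only [hS1, hS2, hS3, hS4]
  ring

/-- **`W_{≤k} ≤ Σ_{i≤f} C(n, i)` once every set of rank `≤ k` has `≤ f` points.** -/
theorem lowCount_le_of_rank_le (M : Matroid α) [M.Finite] {k f : ℕ}
    (hsize : ∀ X ⊆ M.E, M.eRk X ≤ (k : ℕ∞) → X.ncard ≤ f) :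
    lowCount M k ≤ ∑ i ∈ Finset.range (f + 1), M.E.ncard.choose i := by
  rw [← ncard_subsets_ncard_le M.ground_finite f]
  unfold lowCount
  apply Set.ncard_le_ncard
  · rintro A ⟨hA, hr⟩
    exact ⟨hA, hsize A hA hr⟩
  · exact M.ground_finite.finite_subsets.subset fun t ht => ht.1

/-- The size hypothesis survives a deletion. -/
theorem size_delete {M : Matroid α} {k f : ℕ} (hsize : ∀ X ⊆ M.E, M.eRk X ≤ (k : ℕ∞) → X.ncard ≤ f) (D : Set α) :
    ∀ X ⊆ (M ＼ D).E, (M ＼ D).eRk X ≤ (k : ℕ∞) → X.ncard ≤ f := by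
  intro X hX hr
  rw [_root_.Matroid.delete_ground] at hX
  rw [_root_.Matroid.delete_eq_restrict, _root_.Matroid.restrict_eRk_eq _ hX] at hr
  exact hsize X (hX.trans sdiff_subset) hr

/-- **The exact coloop step at level `q`**: `#Y_M(r+1, q) + W_{≤q−1}(M ＼ {e}) = #Y_{M ＼ {e}}(r, q) + 2^{n−1}`. -/
theorem midCount_add_lowCount_of_isColoop_q' (M : Matroid α) [M.Finite] {e : α} (he : M.IsColoop e)
    {r q : ℕ} (hR : M.eRank = ((r + 1 : ℕ) : ℕ∞)) (hq : q < r) (hq1 : 1 ≤ q) :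
    Matroid.midCount M (r + 1) q + lowCount (M ＼ {e}) (q - 1) =
      Matroid.midCount (M ＼ {e}) r q + 2 ^ (M ＼ {e}).E.ncard := by
  obtain ⟨q', rfl⟩ : ∃ q', q = q' + 1 := ⟨q - 1, by omega⟩
  have h := Matroid.midCount_eq_of_isColoop_q he (p := r) (q := q') (by omega)
  have h2 := two_pow_ncard_eq_q (M ＼ {e}) (r := r) (q := q' + 1) (Matroid.eRank_delete_eq he hR) hq hq1
  rw [show q' + 1 - 1 = q' by omega] at h2 ⊢
  omega

/-- **The lossy coloop step at level `q`**: `#Y_M(r+1, q) ≥ 2·#Y_{M ＼ {e}}(r, q) + 2·#U_{M ＼ {e}}(r, q)`. -/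
theorem two_mul_midCount_add_le_of_isColoop_q' (M : Matroid α) [M.Finite] {e : α} (he : M.IsColoop e)
    {r q : ℕ} (hq : q < r) (hq1 : 1 ≤ q) :
    2 * Matroid.midCount (M ＼ {e}) r q + 2 * Matroid.topCount (M ＼ {e}) r q ≤ Matroid.midCount M (r + 1) q := by
  obtain ⟨q', rfl⟩ : ∃ q', q = q' + 1 := ⟨q - 1, by omega⟩
  have h := Matroid.midCount_eq_of_isColoop_q he (p := r) (q := q') (by omega)
  have h1 := Matroid.topCount_le_levelCount_top (M := M ＼ {e}) r (q' + 1)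
  have h2 := Matroid.topCount_le_levelCount_bot (M := M ＼ {e}) r (q' + 1)
  omega

/-- **THE EXACT LADDER AT LEVEL `q`**: `M` of rank `p + c` (`q < p`, `q ≥ 1`) with `≥ c` coloops, every set of rank
`≤ q − 1` of `≤ f` points: a sub-core `N` (`c` coloops deleted) with `#U_M(p+c, q) = #U_N(p, q)` and
`#Y_N(p, q) + Σ_{j<c} 2^{n−1−j} ≤ #Y_M(p+c, q) + Σ_{j<c} Σ_{i≤f} C(n−1−j, i)`. -/
theorem ladder_exact_q (c : ℕ) : ∀ (M : Matroid α) [M.Finite] (p q f : ℕ), M.eRank = ((p + c : ℕ) : ℕ∞) → q < p → 1 ≤ q →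
    c ≤ M.coloops.ncard →
    (∀ X ⊆ M.E, M.eRk X ≤ ((q - 1 : ℕ) : ℕ∞) → X.ncard ≤ f) →
    (∀ e ∈ M.E, ∃ A ⊆ M.E \ {e}, e ∉ M.closure A ∧ e ∉ M.closure ((M.E \ {e}) \ A)) →
    ∃ (N : Matroid α) (_ : N.Finite), N.eRank = (p : ℕ∞) ∧ N.E.ncard + c = M.E.ncard ∧
      N.coloops.ncard + c = M.coloops.ncard ∧
      (∀ e ∈ N.E, ∃ A ⊆ N.E \ {e}, e ∉ N.closure A ∧ e ∉ N.closure ((N.E \ {e}) \ A)) ∧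
      Matroid.topCount M (p + c) q = Matroid.topCount N p q ∧
      Matroid.midCount N p q + ∑ j ∈ Finset.range c, 2 ^ (M.E.ncard - 1 - j) ≤
        Matroid.midCount M (p + c) q + ∑ j ∈ Finset.range c, ∑ i ∈ Finset.range (f + 1), (M.E.ncard - 1 - j).choose i := by
  induction c with
  | zero =>
    intro M _ p q f hR hq hq1 hc hsize hfree
    exact ⟨M, inferInstance, by simpa using hR, by simp, by simp, hfree, rfl, by simp⟩
  | succ c ih =>
    intro M _ p q f hR hq hq1 hc hsize hfree
    have hKfin : M.coloops.Finite := M.ground_finite.subset M.coloops_subset_ground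
    obtain ⟨e, he⟩ : M.coloops.Nonempty := by
      rw [← Set.ncard_pos hKfin]; omega
    have he' : M.IsColoop e := he
    have heE : e ∈ M.E := he'.mem_ground
    have hR1 : M.eRank = ((p + c + 1 : ℕ) : ℕ∞) := by rw [hR, ← Nat.add_assoc]
    have hR' : (M ＼ {e}).eRank = ((p + c : ℕ) : ℕ∞) := Matroid.eRank_delete_eq he' hR1
    have hcol' : (M ＼ {e}).coloops.ncard + 1 = M.coloops.ncard := by
      rw [coloops_delete_singleton_of_isColoop M he']
      exact Set.ncard_sdiff_singleton_add_one he hKfin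
    have hn' : (M ＼ {e}).E.ncard + 1 = M.E.ncard := by
      rw [Matroid.delete_ground]
      exact Set.ncard_sdiff_singleton_add_one heE M.ground_finite
    have hfree' := hfree_delete M hfree e
    have hsize' := size_delete hsize {e}
    obtain ⟨N, hNfin, hNR, hNn, hNcol, hNfree, hNtop, hNmid⟩ :=
      ih (M ＼ {e}) p q f hR' hq hq1 (by omega) hsize' hfree'
    refine ⟨N, hNfin, hNR, by omega, by omega, hNfree, ?_, ?_⟩
    · rw [← hNtop]
      obtain ⟨q', rfl⟩ : ∃ q', q = q' + 1 := ⟨q - 1, by omega⟩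
      have h := Matroid.topCount_eq_of_isColoop_of_eRank he' q' (p := p + c) hR1
      rw [show p + (c + 1) = p + c + 1 by ring]
      exact h
    · have hstep := midCount_add_lowCount_of_isColoop_q' M he' (r := p + c) hR1 (by omega) hq1
      have hlow := lowCount_le_of_rank_le (M ＼ {e}) hsize'
      set n := M.E.ncard with hn
      have hn1 : (M ＼ {e}).E.ncard = n - 1 := by omega
      rw [hn1] at hNmid hlow hstep
      have hs1 : ∑ j ∈ Finset.range (c + 1), 2 ^ (n - 1 - j) =
          2 ^ (n - 1) + ∑ j ∈ Finset.range c, 2 ^ (n - 1 - 1 - j) := by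
        rw [Finset.sum_range_succ', Nat.sub_zero, add_comm]
        congr 1
        exact Finset.sum_congr rfl fun j _ => by rw [show n - 1 - (j + 1) = n - 1 - 1 - j by omega]
      have hs2 : ∑ j ∈ Finset.range (c + 1), ∑ i ∈ Finset.range (f + 1), (n - 1 - j).choose i =
          (∑ i ∈ Finset.range (f + 1), (n - 1).choose i) +
            ∑ j ∈ Finset.range c, ∑ i ∈ Finset.range (f + 1), (n - 1 - 1 - j).choose i := by
        rw [Finset.sum_range_succ', Nat.sub_zero, add_comm]
        congr 1
        exact Finset.sum_congr rfl fun j _ => by rw [show n - 1 - (j + 1) = n - 1 - 1 - j by omega]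
      rw [hs1, hs2, show p + (c + 1) = p + c + 1 by ring]
      omega

/-- **THE LOSSY LADDER AT LEVEL `q`**: `2^c·#Y_N(p, q) + 2(2^c − 1)·#U_N(p, q) ≤ #Y_M(p+c, q)`. -/
theorem ladder_lossy_q (c : ℕ) : ∀ (M : Matroid α) [M.Finite] (p q : ℕ), M.eRank = ((p + c : ℕ) : ℕ∞) → q < p → 1 ≤ q →
    c ≤ M.coloops.ncard →
    ∃ (N : Matroid α) (_ : N.Finite), N.eRank = (p : ℕ∞) ∧
      Matroid.topCount M (p + c) q = Matroid.topCount N p q ∧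
      2 ^ c * Matroid.midCount N p q + 2 * (2 ^ c - 1) * Matroid.topCount N p q ≤ Matroid.midCount M (p + c) q := by
  induction c with
  | zero =>
    intro M _ p q hR hq hq1 hc
    exact ⟨M, inferInstance, by simpa using hR, rfl, by simp⟩
  | succ c ih =>
    intro M _ p q hR hq hq1 hc
    have hKfin : M.coloops.Finite := M.ground_finite.subset M.coloops_subset_ground
    obtain ⟨e, he⟩ : M.coloops.Nonempty := by
      rw [← Set.ncard_pos hKfin]; omega
    have he' : M.IsColoop e := he
    have hR1 : M.eRank = ((p + c + 1 : ℕ) : ℕ∞) := by rw [hR, ← Nat.add_assoc]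
    have hR' : (M ＼ {e}).eRank = ((p + c : ℕ) : ℕ∞) := Matroid.eRank_delete_eq he' hR1
    have hcol' : (M ＼ {e}).coloops.ncard + 1 = M.coloops.ncard := by
      rw [coloops_delete_singleton_of_isColoop M he']
      exact Set.ncard_sdiff_singleton_add_one he hKfin
    obtain ⟨N, hNfin, hNR, hNtop, hNmid⟩ := ih (M ＼ {e}) p q hR' hq hq1 (by omega)
    refine ⟨N, hNfin, hNR, ?_, ?_⟩
    · rw [← hNtop]
      obtain ⟨q', rfl⟩ : ∃ q', q = q' + 1 := ⟨q - 1, by omega⟩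
      have h := Matroid.topCount_eq_of_isColoop_of_eRank he' q' (p := p + c) hR1
      rw [show p + (c + 1) = p + c + 1 by ring]
      exact h
    · have hstep := two_mul_midCount_add_le_of_isColoop_q' M he' (r := p + c) (by omega) hq1
      rw [show p + (c + 1) = p + c + 1 by ring, pow_succ]
      rw [hNtop] at hstep
      have hX : 1 ≤ 2 ^ c := Nat.one_le_two_pow
      set X := 2 ^ c with hXdef
      set A := Matroid.midCount N p q
      set T := Matroid.topCount N p q
      set B := Matroid.midCount (M ＼ {e}) (p + c) q
      set C := Matroid.midCount M (p + c + 1) q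
      have h1 : 2 * (X * 2 - 1) * T = 2 * (2 * (X - 1) * T) + 2 * T := by
        have : X * 2 - 1 = 2 * (X - 1) + 1 := by omega
        rw [this]; ring
      have h2 : X * 2 * A = 2 * (X * A) := by ring
      rw [h1, h2]
      omega

/-- **`RLS` FROM MANY COLOOPS ALONE, AT LEVEL `q`**: `Φ(p + c, q) ≤ 2(2^c − 1)` ⇒ `RLS` at `(p + c, q)`. -/
theorem rls_of_coloops_lossy_q (M : Matroid α) [M.Finite] {p q c : ℕ} (hR : M.eRank = ((p + c : ℕ) : ℕ∞))
    (hq : q < p) (hq1 : 1 ≤ q) (hc : c ≤ M.coloops.ncard) (hΦ : phiK (p + c) q ≤ 2 * ((2 : ℚ) ^ c - 1)) :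
    ThmN.RLS M (p + c) q := by
  obtain ⟨N, hNfin, -, hNtop, hNmid⟩ := ladder_lossy_q c M p q hR hq hq1 hc
  rw [ThmN.RLS_iff, hNtop]
  have hX : 1 ≤ 2 ^ c := Nat.one_le_two_pow
  have hmidQ : (2 : ℚ) * ((2 : ℚ) ^ c - 1) * (Matroid.topCount N p q : ℚ) ≤ (Matroid.midCount M (p + c) q : ℚ) := by
    have h : ((2 * (2 ^ c - 1) * Matroid.topCount N p q : ℕ) : ℚ) ≤ ((Matroid.midCount M (p + c) q : ℕ) : ℚ) := by
      exact_mod_cast (le_trans (Nat.le_add_left _ _) hNmid)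
    rw [Nat.cast_mul, Nat.cast_mul, Nat.cast_sub hX] at h
    push_cast at h
    linarith
  have hT : (0 : ℚ) ≤ (Matroid.topCount N p q : ℚ) := by positivity
  nlinarith [mul_le_mul_of_nonneg_right hΦ hT]

end S1

end PercRepro
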